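import Summits.CriticalPhenomena.PercolationContinuityZ3.Theorems.PercNearOneGluingNoHeavyLowerTailSahiE3ExchangeEmptyLayer
import Mathlib.Tactic.Linarith
import Mathlib.Tactic.Ring
import Mathlib.Tactic.Positivity
import HarnessLib
import HarnessLib.Audit

/-!
# `NoHeavyLowerTail` (crux stmt-CriticalPhenomena-4575), Sahi programme P4: the 2×2 exchange lemma — the one-side-nested classes via the asymmetric diamond packing

Support file (cell `prim-l12`, seat P4, generation 21; `--supports stmt-CriticalPhenomena-4575`).  No named facts, no sorries;
standard axioms; def-free.

Context (HOME prim-l12-p4/FROM-prim-l12-p4-gen21-SATURATED-EXCHANGE.md §7; predecessors `…SahiE3ExchangeCross` (Ξ = ∅),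
`…SahiE3ExchangeEmptyLayer` (L = O = ∅ / K = O = ∅), `…SahiE3ExchangeSubpairs` (reduction to admissible sub-pairs)).
Configuration of up-sets `O ⊆ K∩L`, `K∪L ⊆ P` and `O' ⊆ K'∩L'`, `K'∪L' ⊆ P'` of a Harris block `(B,w,V)`, pair-certificate
`R ≥ 0` on `V`.  When the UNPRIMED side is nested, `L ⊆ K` (so the second crossing cell `V∩(L∖K)∩(K'∖L')` is empty but the
first one `V∩(K∖L)∩(L'∖K')` is arbitrary), the ASYMMETRIC DIAMOND packing `{(K, K'∩L'), (L, K'∪L')}` is admissible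
(`nestedLK_footprints_le_supply`: pointwise `1_{K(K'∩L')} + 1_{L(K'∪L')} ≤ 1_{KK'} + 1_{LL'}` given `L ⊆ K`) and leaves exactly
the deficit `need(K∖L, L'∖K')` (bilinearity of `need`).  This deficit is paid by the base terms whenever ONE of the two corner
layers misses the slot — `O ∩ V = ∅` (`exchange_nestedLK_cornerO`) or `O' ∩ V = ∅` (`exchange_nestedLK_cornerO'`) — with the
explicit nonnegative decompositions (O∩V = ∅; `d = w(K)−w(L)`, `e' = w(L')−w(K'∩L')`)
  `Har(P;P'_V) + [p·(a(P')−a(O')) − d·(a(L')−a(K'∩L'))] + e'·[d − (a(K)−a(L))] + (1−v)·[Y − d·e']`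
and (O'∩V = ∅) `Har(P';P_V) + [p'·(a(P)−a(O)) − e'·(a(K)−a(L))] + d·[e' − (a(L')−a(K'∩L'))] + (1−v)·[Y − d·e']`,
valid for ANY bracket value `Y ≥ d·e'` — in particular the type-2 bracket `Har(P,P') + (p−k)(p'−l') + (p−l)(p'−k')` and the
type-1 bracket `Har(P,P') + (p−k)(k'−o') + (p−o)(p'−k')` of the OR-peel (both dominate `d·e'` termwise under the nestings).
The mirror class `K ⊆ L` (packing `{(L, K'∩L'), (K, K'∪L')}`, deficit `need(L∖K, K'∖L')`) is `exchange_nestedKL_cornerO /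
_cornerO'`.  The classes `L = O = ∅`, `K = O = ∅` of `…SahiE3ExchangeEmptyLayer` are the special cases `L = ∅`, `K = ∅`.
Numerically (lab/e50, e52) these packings certify every one-side-nested configuration with a V-null corner (0 failures /
4·10⁵, both brackets; the decompositions are identities); with BOTH corners meeting `V` the diamond packing can fail (1 / 4·10⁵).
By the σ-symmetry of the type-2 expression (`(K,L,P,O) ↔ (L',K',P',O')`) the same theorems cover a nested PRIMED side.
-/

namespace Summit.CriticalPhenomena.PercolationContinuityZ3.Theorems.SahiE3ExchangeNested

open Finset SahiE3DimerPacking SahiE3ExchangeCross SahiE3ExchangeEmptyLayer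
open scoped BigOperators

variable {B : Type*} [DecidableEq B]

/-- **Admissibility of the asymmetric diamond packing.**  If `R ≥ 0` on `V` and `L ⊆ K`, then
`R(K∩(K'∩L')∩V) + R(L∩(K'∪L')∩V) ≤ R(K∩K'∩V) + R(L∩L'∩V)` (pointwise `1_{K(K'∩L')} + 1_{L(K'∪L')} ≤ 1_{KK'} + 1_{LL'}`).
[this work] -/
theorem nestedLK_footprints_le_supply (R : B → ℝ) (V K L K' L' : Finset B) (hR : ∀ b ∈ V, 0 ≤ R b) (hLK : L ⊆ K) :
    ∑ b ∈ (K ∩ (K' ∩ L')) ∩ V, R b + ∑ b ∈ (L ∩ (K' ∪ L')) ∩ V, R b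
      ≤ ∑ b ∈ (K ∩ K') ∩ V, R b + ∑ b ∈ (L ∩ L') ∩ V, R b := by
  simp only [sum_inter_eq_sum_ite, ← Finset.sum_add_distrib]
  refine Finset.sum_le_sum fun b hb => ?_
  have hRb := hR b hb
  by_cases hk : b ∈ K <;> by_cases hl : b ∈ L <;> by_cases hk' : b ∈ K' <;> by_cases hl' : b ∈ L' <;>
    simp only [Finset.mem_inter, Finset.mem_union, hk, hl, hk', hl', and_true, and_false,
      and_self, or_true, or_false, ↓reduceIte, add_zero, zero_add, le_refl] <;>
    first
      | exact absurd (hLK hl) hk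
      | linarith

/-- A trace difference is at most the mass difference: for `w ≥ 0` and `L ⊆ K`, `w(K∩V) − w(L∩V) ≤ w(K) − w(L)`
(pointwise `1_L + 1_{K∩V} ≤ 1_K + 1_{L∩V}`). [folklore] -/
theorem trace_diff_le (w : B → ℝ) (V K L : Finset B) (hw : ∀ b, 0 ≤ w b) (hLK : L ⊆ K) :
    (∑ b ∈ K ∩ V, w b) - ∑ b ∈ L ∩ V, w b ≤ (∑ b ∈ K, w b) - ∑ b ∈ L, w b := by
  have hsub : L ∩ V ⊆ K ∩ V := Finset.inter_subset_inter hLK le_rfl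
  rw [← Finset.sum_sdiff_eq_sub hsub, ← Finset.sum_sdiff_eq_sub hLK]
  apply Finset.sum_le_sum_of_subset_of_nonneg
  · intro b hb
    simp only [Finset.mem_sdiff, Finset.mem_inter, not_and] at hb ⊢
    exact ⟨hb.1.1, fun hbL => hb.2 hbL hb.1.2⟩
  · intro b _ _; exact hw b

/-- Inclusion–exclusion for a union, traced on `T`: `w((K'∪L')∩T) = w(K'∩T) + w(L'∩T) − w((K'∩L')∩T)`. [folklore] -/
theorem sum_union_trace (w : B → ℝ) (T K' L' : Finset B) :
    ∑ b ∈ (K' ∪ L') ∩ T, w b = ∑ b ∈ K' ∩ T, w b + ∑ b ∈ L' ∩ T, w b - ∑ b ∈ (K' ∩ L') ∩ T, w b := by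
  have h := Finset.sum_union_inter (s₁ := K' ∩ T) (s₂ := L' ∩ T) (f := w)
  have hu : K' ∩ T ∪ L' ∩ T = (K' ∪ L') ∩ T := (Finset.union_inter_distrib_right K' L' T).symm
  have hi : K' ∩ T ∩ (L' ∩ T) = (K' ∩ L') ∩ T := by
    ext b; simp only [Finset.mem_inter]; tauto
  rw [hu, hi] at h
  linarith

/-- **Nested unprimed side `L ⊆ K`, corner `O` off the slot (`O ∩ V = ∅`).**  `B` finite, `w ≥ 0` of total mass `1`, `R ≥ 0` on
`V`; nestings `O ⊆ L ⊆ K ⊆ P`, `O' ⊆ K'`, `O' ⊆ L'`, `K' ⊆ P'`, `L' ⊆ P'`; the pair inequality at the two diamond pairs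
`(K, K'∩L')`, `(L, K'∪L')`; Harris for `(P, P'∩V)`; and a bracket value `Y ≥ (w(K)−w(L))·(w(L')−w(K'∩L'))`.  Then the exchange
expression with bracket `Y` is nonnegative:
`w(PP'V) + w(OO'V) − w(P)w(O'V) − w(P')w(OV) + R(KK'V) + R(LL'V) − need(K,L') − need(L,K') + (1−v)·Y ≥ 0`. [this work] -/
theorem exchange_nestedLK_cornerO [Fintype B] (w R : B → ℝ) (hw : ∀ b, 0 ≤ w b) (hw1 : ∑ b, w b = 1)
    (V K L P O K' L' P' O' : Finset B) (Y : ℝ) (hR : ∀ b ∈ V, 0 ≤ R b)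
    (hLK : L ⊆ K) (hKP : K ⊆ P) (hOK' : O' ⊆ K') (hKP' : K' ⊆ P') (hLP' : L' ⊆ P')
    (hOV : O ∩ V = ∅)
    (hpair₁ : (∑ b ∈ K, w b) * (∑ b ∈ (K' ∩ L') ∩ V, w b) + (∑ b ∈ K' ∩ L', w b) * (∑ b ∈ K ∩ V, w b)
        - (∑ b ∈ V, w b) * (∑ b ∈ K, w b) * (∑ b ∈ K' ∩ L', w b) ≤ ∑ b ∈ (K ∩ (K' ∩ L')) ∩ V, R b)
    (hpair₂ : (∑ b ∈ L, w b) * (∑ b ∈ (K' ∪ L') ∩ V, w b) + (∑ b ∈ K' ∪ L', w b) * (∑ b ∈ L ∩ V, w b)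
        - (∑ b ∈ V, w b) * (∑ b ∈ L, w b) * (∑ b ∈ K' ∪ L', w b) ≤ ∑ b ∈ (L ∩ (K' ∪ L')) ∩ V, R b)
    (hHarV : (∑ b ∈ P, w b) * (∑ b ∈ P' ∩ V, w b) ≤ ∑ b ∈ (P ∩ P') ∩ V, w b)
    (hY : ((∑ b ∈ K, w b) - ∑ b ∈ L, w b) * ((∑ b ∈ L', w b) - ∑ b ∈ K' ∩ L', w b) ≤ Y) :
    0 ≤ (∑ b ∈ (P ∩ P') ∩ V, w b) + (∑ b ∈ (O ∩ O') ∩ V, w b)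
        - (∑ b ∈ P, w b) * (∑ b ∈ O' ∩ V, w b) - (∑ b ∈ P', w b) * (∑ b ∈ O ∩ V, w b)
        + (∑ b ∈ (K ∩ K') ∩ V, R b) + (∑ b ∈ (L ∩ L') ∩ V, R b)
        - ((∑ b ∈ K, w b) * (∑ b ∈ L' ∩ V, w b) + (∑ b ∈ L', w b) * (∑ b ∈ K ∩ V, w b)
            - (∑ b ∈ V, w b) * (∑ b ∈ K, w b) * (∑ b ∈ L', w b))
        - ((∑ b ∈ L, w b) * (∑ b ∈ K' ∩ V, w b) + (∑ b ∈ K', w b) * (∑ b ∈ L ∩ V, w b)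
            - (∑ b ∈ V, w b) * (∑ b ∈ L, w b) * (∑ b ∈ K', w b))
        + (1 - ∑ b ∈ V, w b) * Y := by
  have hsup := nestedLK_footprints_le_supply R V K L K' L' hR hLK
  -- the O-sums vanish
  have hOO : (O ∩ O') ∩ V = ∅ := by
    apply Finset.subset_empty.1; rw [← hOV]
    exact Finset.inter_subset_inter Finset.inter_subset_left le_rfl
  simp only [hOO, hOV, Finset.sum_empty, add_zero, mul_zero, sub_zero]
  -- inclusion–exclusion for J' = K' ∪ L'
  have hJ : ∑ b ∈ K' ∪ L', w b = ∑ b ∈ K', w b + ∑ b ∈ L', w b - ∑ b ∈ K' ∩ L', w b := by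
    have := sum_union_trace w (Finset.univ : Finset B) K' L'
    simpa only [Finset.inter_univ] using this
  have hJV := sum_union_trace w V K' L'
  rw [hJ, hJV] at hpair₂
  -- four-set and trace facts
  have h4V := union_inter_le w V K' L' P' (fun b _ => hw b) hKP' hLP'
  have hOK'V : ∑ b ∈ O' ∩ V, w b ≤ ∑ b ∈ K' ∩ V, w b :=
    sum_le_sum_of_subset' w hw (Finset.inter_subset_inter hOK' le_rfl)
  have hcD := trace_diff_le w V K L hw hLK
  have hv1 : ∑ b ∈ V, w b ≤ 1 := by
    rw [← hw1]; exact sum_le_sum_of_subset' w hw (Finset.subset_univ V)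
  have hl0 : 0 ≤ ∑ b ∈ L, w b := Finset.sum_nonneg fun b _ => hw b
  have hlk : ∑ b ∈ L, w b ≤ ∑ b ∈ K, w b := sum_le_sum_of_subset' w hw hLK
  have hkp : ∑ b ∈ K, w b ≤ ∑ b ∈ P, w b := sum_le_sum_of_subset' w hw hKP
  have hML'w : ∑ b ∈ K' ∩ L', w b ≤ ∑ b ∈ L', w b := sum_le_sum_of_subset' w hw Finset.inter_subset_right
  have hML'V : ∑ b ∈ (K' ∩ L') ∩ V, w b ≤ ∑ b ∈ L' ∩ V, w b :=
    sum_le_sum_of_subset' w hw (Finset.inter_subset_inter Finset.inter_subset_right le_rfl)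
  set p := ∑ b ∈ P, w b
  set k := ∑ b ∈ K, w b
  set l := ∑ b ∈ L, w b
  set v := ∑ b ∈ V, w b
  set aK := ∑ b ∈ K ∩ V, w b
  set aL := ∑ b ∈ L ∩ V, w b
  set p' := ∑ b ∈ P', w b
  set k' := ∑ b ∈ K', w b
  set l' := ∑ b ∈ L', w b
  set m' := ∑ b ∈ K' ∩ L', w b
  set aP' := ∑ b ∈ P' ∩ V, w b
  set aK' := ∑ b ∈ K' ∩ V, w b
  set aL' := ∑ b ∈ L' ∩ V, w b
  set aO' := ∑ b ∈ O' ∩ V, w b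
  set aM' := ∑ b ∈ (K' ∩ L') ∩ V, w b
  have F2 : (k - l) * (aL' - aM') ≤ p * (aP' - aO') := by
    have h1 : aL' - aM' ≤ aP' - aO' := by linarith
    have h2 : 0 ≤ aL' - aM' := by linarith
    have h3 : k - l ≤ p := by linarith
    calc (k - l) * (aL' - aM') ≤ (k - l) * (aP' - aO') := mul_le_mul_of_nonneg_left h1 (by linarith)
      _ ≤ p * (aP' - aO') := mul_le_mul_of_nonneg_right h3 (by linarith)
  have F3 : 0 ≤ (l' - m') * ((k - l) - (aK - aL)) := mul_nonneg (by linarith) (by linarith)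
  have F4 : 0 ≤ (1 - v) * (Y - (k - l) * (l' - m')) := mul_nonneg (by linarith) (by linarith)
  nlinarith [hsup, hpair₁, hpair₂, hHarV, F2, F3, F4]

/-- **Nested unprimed side `L ⊆ K`, corner `O'` off the slot (`O' ∩ V = ∅`).**  Same packing and hypotheses as
`exchange_nestedLK_cornerO` but with Harris for `(P', P∩V)` and `O' ∩ V = ∅` in place of `O ∩ V = ∅`. [this work] -/
theorem exchange_nestedLK_cornerO' [Fintype B] (w R : B → ℝ) (hw : ∀ b, 0 ≤ w b) (hw1 : ∑ b, w b = 1)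
    (V K L P O K' L' P' O' : Finset B) (Y : ℝ) (hR : ∀ b ∈ V, 0 ≤ R b)
    (hOL : O ⊆ L) (hLK : L ⊆ K) (hKP : K ⊆ P) (hKP' : K' ⊆ P') (hLP' : L' ⊆ P')
    (hO'V : O' ∩ V = ∅)
    (hpair₁ : (∑ b ∈ K, w b) * (∑ b ∈ (K' ∩ L') ∩ V, w b) + (∑ b ∈ K' ∩ L', w b) * (∑ b ∈ K ∩ V, w b)
        - (∑ b ∈ V, w b) * (∑ b ∈ K, w b) * (∑ b ∈ K' ∩ L', w b) ≤ ∑ b ∈ (K ∩ (K' ∩ L')) ∩ V, R b)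
    (hpair₂ : (∑ b ∈ L, w b) * (∑ b ∈ (K' ∪ L') ∩ V, w b) + (∑ b ∈ K' ∪ L', w b) * (∑ b ∈ L ∩ V, w b)
        - (∑ b ∈ V, w b) * (∑ b ∈ L, w b) * (∑ b ∈ K' ∪ L', w b) ≤ ∑ b ∈ (L ∩ (K' ∪ L')) ∩ V, R b)
    (hHarV' : (∑ b ∈ P', w b) * (∑ b ∈ P ∩ V, w b) ≤ ∑ b ∈ (P ∩ P') ∩ V, w b)
    (hY : ((∑ b ∈ K, w b) - ∑ b ∈ L, w b) * ((∑ b ∈ L', w b) - ∑ b ∈ K' ∩ L', w b) ≤ Y) :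
    0 ≤ (∑ b ∈ (P ∩ P') ∩ V, w b) + (∑ b ∈ (O ∩ O') ∩ V, w b)
        - (∑ b ∈ P, w b) * (∑ b ∈ O' ∩ V, w b) - (∑ b ∈ P', w b) * (∑ b ∈ O ∩ V, w b)
        + (∑ b ∈ (K ∩ K') ∩ V, R b) + (∑ b ∈ (L ∩ L') ∩ V, R b)
        - ((∑ b ∈ K, w b) * (∑ b ∈ L' ∩ V, w b) + (∑ b ∈ L', w b) * (∑ b ∈ K ∩ V, w b)
            - (∑ b ∈ V, w b) * (∑ b ∈ K, w b) * (∑ b ∈ L', w b))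
        - ((∑ b ∈ L, w b) * (∑ b ∈ K' ∩ V, w b) + (∑ b ∈ K', w b) * (∑ b ∈ L ∩ V, w b)
            - (∑ b ∈ V, w b) * (∑ b ∈ L, w b) * (∑ b ∈ K', w b))
        + (1 - ∑ b ∈ V, w b) * Y := by
  have hsup := nestedLK_footprints_le_supply R V K L K' L' hR hLK
  have hOO : (O ∩ O') ∩ V = ∅ := by
    apply Finset.subset_empty.1; rw [← hO'V]
    exact Finset.inter_subset_inter Finset.inter_subset_right le_rfl
  simp only [hOO, hO'V, Finset.sum_empty, add_zero, mul_zero, sub_zero]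
  have hJ : ∑ b ∈ K' ∪ L', w b = ∑ b ∈ K', w b + ∑ b ∈ L', w b - ∑ b ∈ K' ∩ L', w b := by
    have := sum_union_trace w (Finset.univ : Finset B) K' L'
    simpa only [Finset.inter_univ] using this
  have hJV := sum_union_trace w V K' L'
  rw [hJ, hJV] at hpair₂
  have h4 : ∑ b ∈ K', w b + ∑ b ∈ L', w b ≤ ∑ b ∈ P', w b + ∑ b ∈ K' ∩ L', w b := by
    have := union_inter_le w (Finset.univ : Finset B) K' L' P' (fun b _ => hw b) hKP' hLP'
    simpa only [Finset.inter_univ] using this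
  have hcE' := trace_diff_le w V L' (K' ∩ L') hw Finset.inter_subset_right
  have haPO : ∑ b ∈ K ∩ V, w b - ∑ b ∈ L ∩ V, w b ≤ ∑ b ∈ P ∩ V, w b - ∑ b ∈ O ∩ V, w b := by
    have h1 : ∑ b ∈ K ∩ V, w b ≤ ∑ b ∈ P ∩ V, w b := sum_le_sum_of_subset' w hw (Finset.inter_subset_inter hKP le_rfl)
    have h2 : ∑ b ∈ O ∩ V, w b ≤ ∑ b ∈ L ∩ V, w b := sum_le_sum_of_subset' w hw (Finset.inter_subset_inter hOL le_rfl)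
    linarith
  have haLK : ∑ b ∈ L ∩ V, w b ≤ ∑ b ∈ K ∩ V, w b := sum_le_sum_of_subset' w hw (Finset.inter_subset_inter hLK le_rfl)
  have hv1 : ∑ b ∈ V, w b ≤ 1 := by
    rw [← hw1]; exact sum_le_sum_of_subset' w hw (Finset.subset_univ V)
  have hl0 : 0 ≤ ∑ b ∈ L, w b := Finset.sum_nonneg fun b _ => hw b
  have hlk : ∑ b ∈ L, w b ≤ ∑ b ∈ K, w b := sum_le_sum_of_subset' w hw hLK
  have hp'0 : 0 ≤ ∑ b ∈ P', w b := Finset.sum_nonneg fun b _ => hw b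
  have hk'nn : 0 ≤ ∑ b ∈ K', w b := Finset.sum_nonneg fun b _ => hw b
  have hl'nn : 0 ≤ ∑ b ∈ L', w b := Finset.sum_nonneg fun b _ => hw b
  have hML'w : ∑ b ∈ K' ∩ L', w b ≤ ∑ b ∈ L', w b := sum_le_sum_of_subset' w hw Finset.inter_subset_right
  have hk'0 : 0 ≤ ∑ b ∈ K' ∩ L', w b := Finset.sum_nonneg fun b _ => hw b
  set p := ∑ b ∈ P, w b
  set k := ∑ b ∈ K, w b
  set l := ∑ b ∈ L, w b
  set v := ∑ b ∈ V, w b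
  set aP := ∑ b ∈ P ∩ V, w b
  set aK := ∑ b ∈ K ∩ V, w b
  set aL := ∑ b ∈ L ∩ V, w b
  set aO := ∑ b ∈ O ∩ V, w b
  set p' := ∑ b ∈ P', w b
  set k' := ∑ b ∈ K', w b
  set l' := ∑ b ∈ L', w b
  set m' := ∑ b ∈ K' ∩ L', w b
  set aL' := ∑ b ∈ L' ∩ V, w b
  set aM' := ∑ b ∈ (K' ∩ L') ∩ V, w b
  have F2 : (l' - m') * (aK - aL) ≤ p' * (aP - aO) := by
    have h1 : aK - aL ≤ aP - aO := haPO
    have h2 : 0 ≤ aK - aL := by linarith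
    have h3 : l' - m' ≤ p' := by linarith
    calc (l' - m') * (aK - aL) ≤ (l' - m') * (aP - aO) := mul_le_mul_of_nonneg_left h1 (by linarith)
      _ ≤ p' * (aP - aO) := mul_le_mul_of_nonneg_right h3 (by linarith)
  have F3 : 0 ≤ (k - l) * ((l' - m') - (aL' - aM')) := mul_nonneg (by linarith) (by linarith)
  have F4 : 0 ≤ (1 - v) * (Y - (k - l) * (l' - m')) := mul_nonneg (by linarith) (by linarith)
  nlinarith [hsup, hpair₁, hpair₂, hHarV', F2, F3, F4]

/-- **Admissibility of the mirror diamond packing** (`K ⊆ L`): `R(L∩(K'∩L')∩V) + R(K∩(K'∪L')∩V) ≤ R(KK'V) + R(LL'V)`.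
[this work] -/
theorem nestedKL_footprints_le_supply (R : B → ℝ) (V K L K' L' : Finset B) (hR : ∀ b ∈ V, 0 ≤ R b) (hKL : K ⊆ L) :
    ∑ b ∈ (L ∩ (K' ∩ L')) ∩ V, R b + ∑ b ∈ (K ∩ (K' ∪ L')) ∩ V, R b
      ≤ ∑ b ∈ (K ∩ K') ∩ V, R b + ∑ b ∈ (L ∩ L') ∩ V, R b := by
  have h := nestedLK_footprints_le_supply R V L K L' K' hR hKL
  rw [Finset.inter_comm L' K', Finset.union_comm L' K'] at h
  linarith

/-- **Nested unprimed side `K ⊆ L`, corner `O` off the slot.**  Packing `{(L, K'∩L'), (K, K'∪L')}`, deficit `need(L∖K, K'∖L')`,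
bracket `Y ≥ (w(L)−w(K))·(w(K')−w(K'∩L'))`; Harris for `(P, P'∩V)`; `O ∩ V = ∅`. [this work] -/
theorem exchange_nestedKL_cornerO [Fintype B] (w R : B → ℝ) (hw : ∀ b, 0 ≤ w b) (hw1 : ∑ b, w b = 1)
    (V K L P O K' L' P' O' : Finset B) (Y : ℝ) (hR : ∀ b ∈ V, 0 ≤ R b)
    (hKL : K ⊆ L) (hLP : L ⊆ P) (hOL' : O' ⊆ L') (hKP' : K' ⊆ P') (hLP' : L' ⊆ P')
    (hOV : O ∩ V = ∅)
    (hpair₁ : (∑ b ∈ L, w b) * (∑ b ∈ (K' ∩ L') ∩ V, w b) + (∑ b ∈ K' ∩ L', w b) * (∑ b ∈ L ∩ V, w b)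
        - (∑ b ∈ V, w b) * (∑ b ∈ L, w b) * (∑ b ∈ K' ∩ L', w b) ≤ ∑ b ∈ (L ∩ (K' ∩ L')) ∩ V, R b)
    (hpair₂ : (∑ b ∈ K, w b) * (∑ b ∈ (K' ∪ L') ∩ V, w b) + (∑ b ∈ K' ∪ L', w b) * (∑ b ∈ K ∩ V, w b)
        - (∑ b ∈ V, w b) * (∑ b ∈ K, w b) * (∑ b ∈ K' ∪ L', w b) ≤ ∑ b ∈ (K ∩ (K' ∪ L')) ∩ V, R b)
    (hHarV : (∑ b ∈ P, w b) * (∑ b ∈ P' ∩ V, w b) ≤ ∑ b ∈ (P ∩ P') ∩ V, w b)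
    (hY : ((∑ b ∈ L, w b) - ∑ b ∈ K, w b) * ((∑ b ∈ K', w b) - ∑ b ∈ K' ∩ L', w b) ≤ Y) :
    0 ≤ (∑ b ∈ (P ∩ P') ∩ V, w b) + (∑ b ∈ (O ∩ O') ∩ V, w b)
        - (∑ b ∈ P, w b) * (∑ b ∈ O' ∩ V, w b) - (∑ b ∈ P', w b) * (∑ b ∈ O ∩ V, w b)
        + (∑ b ∈ (K ∩ K') ∩ V, R b) + (∑ b ∈ (L ∩ L') ∩ V, R b)
        - ((∑ b ∈ K, w b) * (∑ b ∈ L' ∩ V, w b) + (∑ b ∈ L', w b) * (∑ b ∈ K ∩ V, w b)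
            - (∑ b ∈ V, w b) * (∑ b ∈ K, w b) * (∑ b ∈ L', w b))
        - ((∑ b ∈ L, w b) * (∑ b ∈ K' ∩ V, w b) + (∑ b ∈ K', w b) * (∑ b ∈ L ∩ V, w b)
            - (∑ b ∈ V, w b) * (∑ b ∈ L, w b) * (∑ b ∈ K', w b))
        + (1 - ∑ b ∈ V, w b) * Y := by
  have hsup := nestedKL_footprints_le_supply R V K L K' L' hR hKL
  have hOO : (O ∩ O') ∩ V = ∅ := by
    apply Finset.subset_empty.1; rw [← hOV]
    exact Finset.inter_subset_inter Finset.inter_subset_left le_rfl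
  simp only [hOO, hOV, Finset.sum_empty, add_zero, mul_zero, sub_zero]
  have hJ : ∑ b ∈ K' ∪ L', w b = ∑ b ∈ K', w b + ∑ b ∈ L', w b - ∑ b ∈ K' ∩ L', w b := by
    have := sum_union_trace w (Finset.univ : Finset B) K' L'
    simpa only [Finset.inter_univ] using this
  have hJV := sum_union_trace w V K' L'
  rw [hJ, hJV] at hpair₂
  have h4V := union_inter_le w V K' L' P' (fun b _ => hw b) hKP' hLP'
  have hOL'V : ∑ b ∈ O' ∩ V, w b ≤ ∑ b ∈ L' ∩ V, w b :=
    sum_le_sum_of_subset' w hw (Finset.inter_subset_inter hOL' le_rfl)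
  have hcD := trace_diff_le w V L K hw hKL
  have hv1 : ∑ b ∈ V, w b ≤ 1 := by
    rw [← hw1]; exact sum_le_sum_of_subset' w hw (Finset.subset_univ V)
  have hk0 : 0 ≤ ∑ b ∈ K, w b := Finset.sum_nonneg fun b _ => hw b
  have hkl : ∑ b ∈ K, w b ≤ ∑ b ∈ L, w b := sum_le_sum_of_subset' w hw hKL
  have hlp : ∑ b ∈ L, w b ≤ ∑ b ∈ P, w b := sum_le_sum_of_subset' w hw hLP
  have hMK'w : ∑ b ∈ K' ∩ L', w b ≤ ∑ b ∈ K', w b := sum_le_sum_of_subset' w hw Finset.inter_subset_left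
  have hMK'V : ∑ b ∈ (K' ∩ L') ∩ V, w b ≤ ∑ b ∈ K' ∩ V, w b :=
    sum_le_sum_of_subset' w hw (Finset.inter_subset_inter Finset.inter_subset_left le_rfl)
  set p := ∑ b ∈ P, w b
  set k := ∑ b ∈ K, w b
  set l := ∑ b ∈ L, w b
  set v := ∑ b ∈ V, w b
  set aK := ∑ b ∈ K ∩ V, w b
  set aL := ∑ b ∈ L ∩ V, w b
  set p' := ∑ b ∈ P', w b
  set k' := ∑ b ∈ K', w b
  set l' := ∑ b ∈ L', w b
  set m' := ∑ b ∈ K' ∩ L', w b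
  set aP' := ∑ b ∈ P' ∩ V, w b
  set aK' := ∑ b ∈ K' ∩ V, w b
  set aL' := ∑ b ∈ L' ∩ V, w b
  set aO' := ∑ b ∈ O' ∩ V, w b
  set aM' := ∑ b ∈ (K' ∩ L') ∩ V, w b
  have F2 : (l - k) * (aK' - aM') ≤ p * (aP' - aO') := by
    have h1 : aK' - aM' ≤ aP' - aO' := by linarith
    have h2 : 0 ≤ aK' - aM' := by linarith
    have h3 : l - k ≤ p := by linarith
    calc (l - k) * (aK' - aM') ≤ (l - k) * (aP' - aO') := mul_le_mul_of_nonneg_left h1 (by linarith)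
      _ ≤ p * (aP' - aO') := mul_le_mul_of_nonneg_right h3 (by linarith)
  have F3 : 0 ≤ (k' - m') * ((l - k) - (aL - aK)) := mul_nonneg (by linarith) (by linarith)
  have F4 : 0 ≤ (1 - v) * (Y - (l - k) * (k' - m')) := mul_nonneg (by linarith) (by linarith)
  nlinarith [hsup, hpair₁, hpair₂, hHarV, F2, F3, F4]

/-- **Nested unprimed side `K ⊆ L`, corner `O'` off the slot.**  As `exchange_nestedKL_cornerO` with Harris for `(P', P∩V)`
and `O' ∩ V = ∅`. [this work] -/
theorem exchange_nestedKL_cornerO' [Fintype B] (w R : B → ℝ) (hw : ∀ b, 0 ≤ w b) (hw1 : ∑ b, w b = 1)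
    (V K L P O K' L' P' O' : Finset B) (Y : ℝ) (hR : ∀ b ∈ V, 0 ≤ R b)
    (hOK : O ⊆ K) (hKL : K ⊆ L) (hLP : L ⊆ P) (hKP' : K' ⊆ P') (hLP' : L' ⊆ P')
    (hO'V : O' ∩ V = ∅)
    (hpair₁ : (∑ b ∈ L, w b) * (∑ b ∈ (K' ∩ L') ∩ V, w b) + (∑ b ∈ K' ∩ L', w b) * (∑ b ∈ L ∩ V, w b)
        - (∑ b ∈ V, w b) * (∑ b ∈ L, w b) * (∑ b ∈ K' ∩ L', w b) ≤ ∑ b ∈ (L ∩ (K' ∩ L')) ∩ V, R b)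
    (hpair₂ : (∑ b ∈ K, w b) * (∑ b ∈ (K' ∪ L') ∩ V, w b) + (∑ b ∈ K' ∪ L', w b) * (∑ b ∈ K ∩ V, w b)
        - (∑ b ∈ V, w b) * (∑ b ∈ K, w b) * (∑ b ∈ K' ∪ L', w b) ≤ ∑ b ∈ (K ∩ (K' ∪ L')) ∩ V, R b)
    (hHarV' : (∑ b ∈ P', w b) * (∑ b ∈ P ∩ V, w b) ≤ ∑ b ∈ (P ∩ P') ∩ V, w b)
    (hY : ((∑ b ∈ L, w b) - ∑ b ∈ K, w b) * ((∑ b ∈ K', w b) - ∑ b ∈ K' ∩ L', w b) ≤ Y) :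
    0 ≤ (∑ b ∈ (P ∩ P') ∩ V, w b) + (∑ b ∈ (O ∩ O') ∩ V, w b)
        - (∑ b ∈ P, w b) * (∑ b ∈ O' ∩ V, w b) - (∑ b ∈ P', w b) * (∑ b ∈ O ∩ V, w b)
        + (∑ b ∈ (K ∩ K') ∩ V, R b) + (∑ b ∈ (L ∩ L') ∩ V, R b)
        - ((∑ b ∈ K, w b) * (∑ b ∈ L' ∩ V, w b) + (∑ b ∈ L', w b) * (∑ b ∈ K ∩ V, w b)
            - (∑ b ∈ V, w b) * (∑ b ∈ K, w b) * (∑ b ∈ L', w b))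
        - ((∑ b ∈ L, w b) * (∑ b ∈ K' ∩ V, w b) + (∑ b ∈ K', w b) * (∑ b ∈ L ∩ V, w b)
            - (∑ b ∈ V, w b) * (∑ b ∈ L, w b) * (∑ b ∈ K', w b))
        + (1 - ∑ b ∈ V, w b) * Y := by
  have hsup := nestedKL_footprints_le_supply R V K L K' L' hR hKL
  have hOO : (O ∩ O') ∩ V = ∅ := by
    apply Finset.subset_empty.1; rw [← hO'V]
    exact Finset.inter_subset_inter Finset.inter_subset_right le_rfl
  simp only [hOO, hO'V, Finset.sum_empty, add_zero, mul_zero, sub_zero]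
  have hJ : ∑ b ∈ K' ∪ L', w b = ∑ b ∈ K', w b + ∑ b ∈ L', w b - ∑ b ∈ K' ∩ L', w b := by
    have := sum_union_trace w (Finset.univ : Finset B) K' L'
    simpa only [Finset.inter_univ] using this
  have hJV := sum_union_trace w V K' L'
  rw [hJ, hJV] at hpair₂
  have h4 : ∑ b ∈ K', w b + ∑ b ∈ L', w b ≤ ∑ b ∈ P', w b + ∑ b ∈ K' ∩ L', w b := by
    have := union_inter_le w (Finset.univ : Finset B) K' L' P' (fun b _ => hw b) hKP' hLP'
    simpa only [Finset.inter_univ] using this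
  have hcE : ∑ b ∈ K' ∩ V, w b - ∑ b ∈ (K' ∩ L') ∩ V, w b ≤ ∑ b ∈ K', w b - ∑ b ∈ K' ∩ L', w b :=
    trace_diff_le w V K' (K' ∩ L') hw Finset.inter_subset_left
  have haPO : ∑ b ∈ L ∩ V, w b - ∑ b ∈ K ∩ V, w b ≤ ∑ b ∈ P ∩ V, w b - ∑ b ∈ O ∩ V, w b := by
    have h1 : ∑ b ∈ L ∩ V, w b ≤ ∑ b ∈ P ∩ V, w b := sum_le_sum_of_subset' w hw (Finset.inter_subset_inter hLP le_rfl)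
    have h2 : ∑ b ∈ O ∩ V, w b ≤ ∑ b ∈ K ∩ V, w b := sum_le_sum_of_subset' w hw (Finset.inter_subset_inter hOK le_rfl)
    linarith
  have haKL : ∑ b ∈ K ∩ V, w b ≤ ∑ b ∈ L ∩ V, w b := sum_le_sum_of_subset' w hw (Finset.inter_subset_inter hKL le_rfl)
  have hv1 : ∑ b ∈ V, w b ≤ 1 := by
    rw [← hw1]; exact sum_le_sum_of_subset' w hw (Finset.subset_univ V)
  have hk0 : 0 ≤ ∑ b ∈ K, w b := Finset.sum_nonneg fun b _ => hw b
  have hkl : ∑ b ∈ K, w b ≤ ∑ b ∈ L, w b := sum_le_sum_of_subset' w hw hKL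
  have hp'0 : 0 ≤ ∑ b ∈ P', w b := Finset.sum_nonneg fun b _ => hw b
  have hk'nn : 0 ≤ ∑ b ∈ K', w b := Finset.sum_nonneg fun b _ => hw b
  have hl'nn : 0 ≤ ∑ b ∈ L', w b := Finset.sum_nonneg fun b _ => hw b
  have hMK'w : ∑ b ∈ K' ∩ L', w b ≤ ∑ b ∈ K', w b := sum_le_sum_of_subset' w hw Finset.inter_subset_left
  have hm'0 : 0 ≤ ∑ b ∈ K' ∩ L', w b := Finset.sum_nonneg fun b _ => hw b
  set p := ∑ b ∈ P, w b
  set k := ∑ b ∈ K, w b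
  set l := ∑ b ∈ L, w b
  set v := ∑ b ∈ V, w b
  set aP := ∑ b ∈ P ∩ V, w b
  set aK := ∑ b ∈ K ∩ V, w b
  set aL := ∑ b ∈ L ∩ V, w b
  set aO := ∑ b ∈ O ∩ V, w b
  set p' := ∑ b ∈ P', w b
  set k' := ∑ b ∈ K', w b
  set l' := ∑ b ∈ L', w b
  set m' := ∑ b ∈ K' ∩ L', w b
  set aK' := ∑ b ∈ K' ∩ V, w b
  set aM' := ∑ b ∈ (K' ∩ L') ∩ V, w b
  have F2 : (k' - m') * (aL - aK) ≤ p' * (aP - aO) := by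
    have h1 : aL - aK ≤ aP - aO := haPO
    have h2 : 0 ≤ aL - aK := by linarith
    have h3 : k' - m' ≤ p' := by linarith
    calc (k' - m') * (aL - aK) ≤ (k' - m') * (aP - aO) := mul_le_mul_of_nonneg_left h1 (by linarith)
      _ ≤ p' * (aP - aO) := mul_le_mul_of_nonneg_right h3 (by linarith)
  have F3 : 0 ≤ (l - k) * ((k' - m') - (aK' - aM')) := mul_nonneg (by linarith) (by linarith)
  have F4 : 0 ≤ (1 - v) * (Y - (l - k) * (k' - m')) := mul_nonneg (by linarith) (by linarith)
  nlinarith [hsup, hpair₁, hpair₂, hHarV', F2, F3, F4]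

end Summit.CriticalPhenomena.PercolationContinuityZ3.Theorems.SahiE3ExchangeNested
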